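import Literature.AlgebraicGeometry.Resolution.OriginLocalRing
import Literature.AlgebraicGeometry.Resolution.AdicCompletionSemilocal
import Literature.AlgebraicGeometry.Resolution.AdicCompletionRegular
import Literature.AlgebraicGeometry.Resolution.FormalNormalCrossingsLemmas
import Literature.AlgebraicGeometry.Resolution.RsopMonomialIdeals
import Literature.AlgebraicGeometry.Resolution.RegularLocalRingsJacobian
import Mathlib.RingTheory.MvPowerSeries.Equiv
import Mathlib.RingTheory.MvPowerSeries.Rename
import Mathlib.RingTheory.MvPowerSeries.NoZeroDivisors
import HarnessLib

/-!
# `k⟦X₁, …, Xₙ⟧` is a regular local ring of dimension `n`; partial derivatives; singular points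
of formal hypersurfaces

Topic: `Literature/AlgebraicGeometry/Resolution`. Commutative algebra underneath the formal
models of de Jong 1996, Situation 4.25 (`AlterationsNormalForm.lean`: `MvPowerSeries (Fin d) k`
at the nonsingular points, `k⟦u, v, t₁, …, t_{d-1}⟧/(uv - t₁ ⋯ t_s)` at the singular ones) and
of the chart computation of Claim 4.27 (`AlterationsNormalFormBlowup.lean`). Everything is PROVED:

* `isRegularLocalRing_mvPowerSeries`, `ringKrullDim_mvPowerSeries` — for a field `k` and a finite
  `σ`, `k⟦Xᵢ : i ∈ σ⟧` is a regular local ring of dimension `#σ` (it is the completion of the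
  regular local ring `k[X]_{(X)}` of `𝔸ⁿ` at the origin — Mathlib's
  `MvPowerSeries.toAdicCompletionAlgEquiv` with `adicCompletionAtMaximalEquiv`,
  `isRegularLocalRing_adicCompletion`, `ringKrullDim_adicCompletion` of the tree);
  `mvPowerSeriesEquivAdicCompletionOrigin`, `isRegularLocalRing_mvPowerSeries_fin` (the case
  `σ = Fin n`), `isRegularRing_mvPowerSeries` (Serre), `maximalIdeal_mvPowerSeries_eq_span` (no
  linear order on `σ` needed), `X_mem_maximalIdeal` and `isRsopPart_X`: **the variables form a
  regular system of parameters**, so that every ideal generated by some of the variables is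
  prime with regular quotient of the complementary dimension (`RsopMonomialIdeals.lean`).
* `MvPowerSeries.eulerDerivation i` (`Xᵢ ∂/∂Xᵢ`, multiplying the coefficient of `Xᵉ` by `eᵢ`)
  and `MvPowerSeries.pderiv i` (`∂/∂Xᵢ`), derivations of `R⟦X⟧` with `Xᵢ · ∂ᵢ = Xᵢ ∂/∂Xᵢ`
  (`MvPowerSeries.X_mul_pderiv`), `∂ᵢ Xⱼ = δᵢⱼ` (`MvPowerSeries.pderiv_X`), and `∂ᵢ` of a
  product of distinct variables (`MvPowerSeries.pderiv_prod_X`, `MvPowerSeries.pderiv_prod_X_eq_zero`);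
  `Derivation.apply_prod_eq_zero`.
* `Derivation.apply_mem_of_mul_mem_sq` — Leibniz: for a derivation `D`, a prime `Q ∋ f` and
  `w ∉ Q` with `w f ∈ Q²`, `D f ∈ Q`; `localizationQuotientEquiv` (`(C/(f))_𝔮 ≅ C_𝔮/(f)`) and
  `isRegularLocalRing_localization_quotient_of_forall` (Matsumura 14.2: regular if no `w ∉ 𝔮`
  has `w f ∈ 𝔮²`); whence **the Jacobian necessary condition for a singular point of a
  hypersurface** `exists_mul_mem_sq_of_not_isRegularLocalRing` /
  `Derivation.apply_mem_comap_of_not_isRegularLocalRing`: in a regular ring `C`, if `(C/(f))_𝔮`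
  is not regular then some `w ∉ 𝔮` has `w f ∈ 𝔮²`, hence `D f ∈ 𝔮` for every derivation `D` of
  `C` (Stacks 07PF read contrapositively); and conversely
  `not_isRegularLocalRing_localization_quotient_of_mem_sq`: if `0 ≠ f ∈ 𝔮²` (`C` a regular
  domain) then `(C/(f))_𝔮` is not regular.

Not here: the compatibility of `MvPowerSeries.pderiv` with `MvPolynomial.pderiv` on (images of)
polynomials (not needed by the consumers, which differentiate explicit products of variables).

## Sources

* H. Matsumura, *Commutative Ring Theory*, CUP 1986: §19 p. 158 (proof of Thm. 19.5: a local
  ring is regular iff its completion is), Thm. 14.2, Ex. 25.3. [Matsumura1987]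
* The Stacks Project, Tag 07PF (regularity of `R/(f)` from a derivation). [StacksProject]
* A. J. de Jong, *Smoothness, semi-stability and alterations*, Publ. Math. IHÉS 83 (1996),
  4.25–4.27 (the consumer). [DeJong1996]
-/

noncomputable section

namespace Literature.AlgebraicGeometry.Resolution

universe u v

open IsLocalRing MvPowerSeries

/-! ## `k⟦X₁, …, Xₙ⟧` is regular local of dimension `n` -/

section Regular

variable (k : Type u) [Field k]

/-- `k⟦X₁, …, Xₙ⟧` is isomorphic to the completion of the local ring `k[X]_{(X)}` of affine
space at the origin. [folklore] -/
def mvPowerSeriesEquivAdicCompletionOrigin (n : ℕ) :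
    MvPowerSeries (Fin n) k ≃+*
      AdicCompletion (maximalIdeal (OriginLocalization k n)) (OriginLocalization k n) :=
  have hI : MvPolynomial.idealOfVars (Fin n) k = originIdeal k n := (originIdeal_eq_span k n).symm
  (MvPowerSeries.toAdicCompletionAlgEquiv (Fin n) k).toRingEquiv.trans
    ((adicCompletionEquivOfLE (MvPolynomial.idealOfVars (Fin n) k) (originIdeal k n) (e := 1)
      (by rw [pow_one, hI]) hI.le).trans (adicCompletionAtMaximalEquiv (originIdeal k n)))

/-- **`k⟦X₁, …, Xₙ⟧` is a regular local ring of dimension `n`** (the completion of the regular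
local ring `k[X₁, …, Xₙ]_{(X)}`, of dimension `n`). [cite: Matsumura1987, §19 p. 158] -/
theorem isRegularLocalRing_mvPowerSeries_fin (n : ℕ) :
    IsRegularLocalRing (MvPowerSeries (Fin n) k) ∧ ringKrullDim (MvPowerSeries (Fin n) k) = n := by
  let e := mvPowerSeriesEquivAdicCompletionOrigin k n
  haveI := isRegularLocalRing_adicCompletion (OriginLocalization k n)
  refine ⟨IsRegularLocalRing.of_ringEquiv e.symm, ?_⟩
  rw [ringKrullDim_eq_of_ringEquiv e, ringKrullDim_adicCompletion, ringKrullDim_originLocalization]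

variable (σ : Type v) [Finite σ]

/-- **`k⟦Xᵢ : i ∈ σ⟧` is a regular local ring** for a field `k` and finitely many variables.
[cite: Matsumura1987, §19 p. 158] -/
theorem isRegularLocalRing_mvPowerSeries : IsRegularLocalRing (MvPowerSeries σ k) := by
  obtain ⟨n, ⟨e⟩⟩ := Finite.exists_equiv_fin σ
  haveI := (isRegularLocalRing_mvPowerSeries_fin k n).1
  exact IsRegularLocalRing.of_ringEquiv (MvPowerSeries.renameEquiv k e.symm).toRingEquiv

/-- **`dim k⟦Xᵢ : i ∈ σ⟧ = #σ`.** [cite: Matsumura1987, §19 p. 158] -/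
theorem ringKrullDim_mvPowerSeries : ringKrullDim (MvPowerSeries σ k) = Nat.card σ := by
  obtain ⟨n, ⟨e⟩⟩ := Finite.exists_equiv_fin σ
  rw [← ringKrullDim_eq_of_ringEquiv (MvPowerSeries.renameEquiv k e.symm).toRingEquiv,
    (isRegularLocalRing_mvPowerSeries_fin k n).2, Nat.card_congr e, Nat.card_fin]

/-- `k⟦Xᵢ : i ∈ σ⟧` is a regular ring: all its localisations at primes are regular local rings
(Serre, Matsumura Thm. 19.3). [cite: Matsumura1987, Thm. 19.3] -/
theorem isRegularRing_mvPowerSeries : IsRegularRing (MvPowerSeries σ k) :=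
  haveI := isRegularLocalRing_mvPowerSeries k σ
  isRegularRing_of_isRegularLocalRing _

/-- The maximal ideal of `k⟦Xᵢ : i ∈ σ⟧` is generated by the variables (any finite `σ`; cf.
`maximalIdeal_mvPowerSeries_eq_span_range_X` for linearly ordered `σ`). [folklore] -/
theorem maximalIdeal_mvPowerSeries_eq_span :
    maximalIdeal (MvPowerSeries σ k) =
      Ideal.span (Set.range (MvPowerSeries.X : σ → MvPowerSeries σ k)) := by
  obtain ⟨n, ⟨e⟩⟩ := Finite.exists_equiv_fin σ
  let ε := (MvPowerSeries.renameEquiv k e.symm).toRingEquiv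
  rw [← map_ringEquiv_maximalIdeal ε, maximalIdeal_mvPowerSeries_eq_span_range_X, Ideal.map_span]
  congr 1
  ext φ
  constructor
  · rintro ⟨_, ⟨i, rfl⟩, rfl⟩
    exact ⟨e.symm i, by simp [ε]⟩
  · rintro ⟨j, rfl⟩
    exact ⟨MvPowerSeries.X (e j), ⟨e j, rfl⟩, by simp [ε]⟩

/-- A variable lies in the maximal ideal. [folklore] -/
theorem X_mem_maximalIdeal (i : σ) : (MvPowerSeries.X i : MvPowerSeries σ k) ∈ maximalIdeal _ := by
  rw [maximalIdeal_mvPowerSeries_eq_span]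
  exact Ideal.subset_span ⟨i, rfl⟩

/-- **The variables of `k⟦X₁, …, Xₙ⟧` form a regular system of parameters** (in any
enumeration `e : Fin n ≃ σ`). [cite: Matsumura1987, Thm. 14.2] -/
theorem isRsopPart_X {n : ℕ} (e : Fin n ≃ σ) :
    IsRsopPart (fun i => (MvPowerSeries.X (e i) : MvPowerSeries σ k)) := by
  refine ⟨isRegularLocalRing_mvPowerSeries k σ, 0, Fin.elim0, ?_, ?_⟩
  · rw [ringKrullDim_mvPowerSeries, Nat.card_congr e.symm, Nat.card_fin, Nat.add_zero]
  · have h1 : Set.range (Fin.elim0 : Fin 0 → MvPowerSeries σ k) = ∅ := Set.range_eq_empty _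
    have h2 : Set.range (fun i => (MvPowerSeries.X (e i) : MvPowerSeries σ k)) =
        Set.range (MvPowerSeries.X : σ → MvPowerSeries σ k) :=
      e.surjective.range_comp MvPowerSeries.X
    rw [h1, Set.union_empty, h2, maximalIdeal_mvPowerSeries_eq_span]

end Regular

/-! ## The Euler derivations `Xᵢ ∂/∂Xᵢ` and the partial derivatives `∂/∂Xᵢ` -/

section Derivations

variable {σ : Type v} {R : Type u} [CommRing R]

/-- The **Euler derivation** `Xᵢ ∂/∂Xᵢ` of `R⟦X⟧`: it multiplies the coefficient of `Xᵉ` by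
`eᵢ`. (Leibniz is immediate: for `a + b = e`, `eᵢ = aᵢ + bᵢ`.) [folklore] -/
def MvPowerSeries.eulerDerivation (i : σ) :
    Derivation R (MvPowerSeries σ R) (MvPowerSeries σ R) where
  toFun φ := fun e => (e i : R) * φ e
  map_add' φ ψ := by
    ext e
    change (e i : R) * (φ e + ψ e) = (e i : R) * φ e + (e i : R) * ψ e
    ring
  map_smul' c φ := by
    ext e
    change (e i : R) * (c * φ e) = c * ((e i : R) * φ e)
    ring
  map_one_eq_zero' := by
    classical
    ext e
    change (e i : R) * MvPowerSeries.coeff e (1 : MvPowerSeries σ R) = MvPowerSeries.coeff e 0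
    rw [MvPowerSeries.coeff_one, map_zero]
    split_ifs with h
    · rw [h, Finsupp.zero_apply, Nat.cast_zero, zero_mul]
    · rw [mul_zero]
  leibniz' φ ψ := by
    classical
    ext e
    change (e i : R) * MvPowerSeries.coeff e (φ * ψ) =
      MvPowerSeries.coeff e (φ * (show MvPowerSeries σ R from fun e => (e i : R) * ψ e) +
        ψ * (show MvPowerSeries σ R from fun e => (e i : R) * φ e))
    rw [map_add, MvPowerSeries.coeff_mul, MvPowerSeries.coeff_mul,
      mul_comm ψ (show MvPowerSeries σ R from fun e => (e i : R) * φ e), MvPowerSeries.coeff_mul,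
      Finset.mul_sum, ← Finset.sum_add_distrib]
    refine Finset.sum_congr rfl fun p hp => ?_
    rw [Finset.mem_antidiagonal] at hp
    have he : (e i : R) = (p.1 i : R) + (p.2 i : R) := by
      rw [← hp, Finsupp.add_apply, Nat.cast_add]
    rw [he]
    change _ * (φ p.1 * ψ p.2) = φ p.1 * ((p.2 i : R) * ψ p.2) + (p.1 i : R) * φ p.1 * ψ p.2
    ring

/-- Coefficients of the Euler derivation. [folklore] -/
@[simp]
theorem MvPowerSeries.coeff_eulerDerivation (i : σ) (φ : MvPowerSeries σ R) (e : σ →₀ ℕ) :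
    MvPowerSeries.coeff e (MvPowerSeries.eulerDerivation i φ) = (e i : R) * MvPowerSeries.coeff e φ :=
  rfl

/-- `Xᵢ` is a non-zero-divisor of `R⟦X⟧`: the coefficient of `Xᵢ Xᵉ` in `Xᵢ φ` is that of `Xᵉ`
in `φ`. [folklore] -/
theorem MvPowerSeries.X_mul_cancel {i : σ} {φ ψ : MvPowerSeries σ R}
    (h : MvPowerSeries.X i * φ = MvPowerSeries.X i * ψ) : φ = ψ := by
  ext e
  have := congrArg (MvPowerSeries.coeff (Finsupp.single i 1 + e)) h
  rwa [MvPowerSeries.X_def, MvPowerSeries.coeff_add_monomial_mul,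
    MvPowerSeries.coeff_add_monomial_mul, one_mul, one_mul] at this

/-- The underlying linear map of `∂/∂Xᵢ`: the coefficient of `Xᵉ` is `(eᵢ + 1)` times the
coefficient of `Xᵉ⁺¹ⁱ`. [folklore] -/
def MvPowerSeries.pderivLinearMap (i : σ) : MvPowerSeries σ R →ₗ[R] MvPowerSeries σ R where
  toFun φ := fun e => ((e i : R) + 1) * φ (e + Finsupp.single i 1)
  map_add' φ ψ := by
    ext e
    change ((e i : R) + 1) * (φ (e + Finsupp.single i 1) + ψ (e + Finsupp.single i 1)) =
      ((e i : R) + 1) * φ (e + Finsupp.single i 1) + ((e i : R) + 1) * ψ (e + Finsupp.single i 1)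
    ring
  map_smul' c φ := by
    ext e
    change ((e i : R) + 1) * (c * φ (e + Finsupp.single i 1)) =
      c * (((e i : R) + 1) * φ (e + Finsupp.single i 1))
    ring

/-- Coefficients of `pderivLinearMap`. [folklore] -/
theorem MvPowerSeries.coeff_pderivLinearMap (i : σ) (φ : MvPowerSeries σ R) (e : σ →₀ ℕ) :
    MvPowerSeries.coeff e (MvPowerSeries.pderivLinearMap i φ) =
      ((e i : R) + 1) * MvPowerSeries.coeff (e + Finsupp.single i 1) φ :=
  rfl

/-- `Xᵢ · ∂φ/∂Xᵢ = (Xᵢ ∂/∂Xᵢ) φ`. [folklore] -/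
theorem MvPowerSeries.X_mul_pderivLinearMap (i : σ) (φ : MvPowerSeries σ R) :
    MvPowerSeries.X i * MvPowerSeries.pderivLinearMap i φ = MvPowerSeries.eulerDerivation i φ := by
  classical
  ext m
  rw [MvPowerSeries.X_def, MvPowerSeries.coeff_monomial_mul, MvPowerSeries.coeff_eulerDerivation]
  split_ifs with h
  · rw [one_mul, MvPowerSeries.coeff_pderivLinearMap, tsub_add_cancel_of_le h]
    have hmi : 1 ≤ m i := by simpa [Finsupp.single_le_iff] using h
    congr 1
    rw [Finsupp.tsub_apply, Finsupp.single_eq_same, ← Nat.cast_succ, Nat.succ_eq_add_one,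
      Nat.sub_add_cancel hmi]
  · have hmi : m i = 0 := by
      simpa [Finsupp.single_le_iff] using h
    rw [hmi, Nat.cast_zero, zero_mul]

/-- The **partial derivative** `∂/∂Xᵢ` of `R⟦X⟧`, a derivation (Leibniz follows from that of
`Xᵢ ∂/∂Xᵢ` by cancelling the non-zero-divisor `Xᵢ`). [cite: Matsumura1987, Ex. 25.3] -/
def MvPowerSeries.pderiv (i : σ) : Derivation R (MvPowerSeries σ R) (MvPowerSeries σ R) where
  __ := MvPowerSeries.pderivLinearMap i
  map_one_eq_zero' := by
    classical
    ext e
    change ((e i : R) + 1) * MvPowerSeries.coeff (e + Finsupp.single i 1) (1 : MvPowerSeries σ R) =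
      MvPowerSeries.coeff e 0
    rw [MvPowerSeries.coeff_one, if_neg, mul_zero, map_zero]
    intro h
    have := DFunLike.congr_fun h i
    simp at this
  leibniz' φ ψ := by
    change MvPowerSeries.pderivLinearMap i (φ * ψ) =
      φ * MvPowerSeries.pderivLinearMap i ψ + ψ * MvPowerSeries.pderivLinearMap i φ
    apply MvPowerSeries.X_mul_cancel (i := i)
    rw [MvPowerSeries.X_mul_pderivLinearMap, Derivation.leibniz, smul_eq_mul, smul_eq_mul, mul_add,
      mul_left_comm, MvPowerSeries.X_mul_pderivLinearMap, mul_left_comm,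
      MvPowerSeries.X_mul_pderivLinearMap]

/-- Coefficients of `∂φ/∂Xᵢ`. [folklore] -/
theorem MvPowerSeries.coeff_pderiv (i : σ) (φ : MvPowerSeries σ R) (e : σ →₀ ℕ) :
    MvPowerSeries.coeff e (MvPowerSeries.pderiv i φ) =
      ((e i : R) + 1) * MvPowerSeries.coeff (e + Finsupp.single i 1) φ :=
  rfl

/-- `Xᵢ · ∂φ/∂Xᵢ = (Xᵢ ∂/∂Xᵢ) φ`. [folklore] -/
theorem MvPowerSeries.X_mul_pderiv (i : σ) (φ : MvPowerSeries σ R) :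
    MvPowerSeries.X i * MvPowerSeries.pderiv i φ = MvPowerSeries.eulerDerivation i φ :=
  MvPowerSeries.X_mul_pderivLinearMap i φ

/-- `∂Xⱼ/∂Xᵢ = δᵢⱼ`. [folklore] -/
theorem MvPowerSeries.pderiv_X [DecidableEq σ] (i j : σ) :
    MvPowerSeries.pderiv i (MvPowerSeries.X j : MvPowerSeries σ R) = if j = i then 1 else 0 := by
  ext e
  rw [MvPowerSeries.coeff_pderiv, MvPowerSeries.coeff_X]
  by_cases hji : j = i
  · rw [if_pos hji, hji, MvPowerSeries.coeff_one]
    by_cases he : e = 0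
    · subst he
      simp
    · rw [if_neg, if_neg he, mul_zero]
      intro h
      apply he
      ext x
      have := DFunLike.congr_fun h x
      simpa using this
  · rw [if_neg hji, map_zero, if_neg, mul_zero]
    intro h
    have := DFunLike.congr_fun h i
    simp [hji] at this

/-- A derivation vanishing on every factor of a finite product vanishes on the product.
[folklore] -/
theorem Derivation.apply_prod_eq_zero {S₀ : Type*} [CommSemiring S₀] {A : Type*} [CommRing A]
    [Algebra S₀ A] (D : Derivation S₀ A A) {ι : Type*} (s : Finset ι) (g : ι → A)
    (h : ∀ j ∈ s, D (g j) = 0) : D (∏ j ∈ s, g j) = 0 := by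
  classical
  induction s using Finset.induction_on with
  | empty => simp
  | insert a s ha ih =>
    rw [Finset.prod_insert ha, Derivation.leibniz, ih fun j hj => h j (Finset.mem_insert_of_mem hj),
      h a (Finset.mem_insert_self a s), smul_zero, smul_zero, add_zero]

/-- **`∂/∂Xᵢ` of a product of distinct variables containing `Xᵢ`** is the product of the
others. [folklore] -/
theorem MvPowerSeries.pderiv_prod_X [DecidableEq σ] {ι : Type*} [DecidableEq ι] (s : Finset ι)
    (g : ι → σ) (hg : Set.InjOn g s) {a : ι} (ha : a ∈ s) :
    MvPowerSeries.pderiv (g a) (∏ j ∈ s, (MvPowerSeries.X (g j) : MvPowerSeries σ R)) =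
      ∏ j ∈ s.erase a, MvPowerSeries.X (g j) := by
  rw [← Finset.mul_prod_erase s _ ha, Derivation.leibniz, smul_eq_mul, smul_eq_mul,
    MvPowerSeries.pderiv_X, if_pos rfl, mul_one, Derivation.apply_prod_eq_zero, mul_zero, zero_add]
  intro j hj
  rw [MvPowerSeries.pderiv_X, if_neg]
  intro hji
  exact (Finset.mem_erase.mp hj).1 (hg (Finset.mem_of_mem_erase hj) ha hji)

/-- `∂/∂Xᵢ` kills a product of variables not containing `Xᵢ`. [folklore] -/
theorem MvPowerSeries.pderiv_prod_X_eq_zero [DecidableEq σ] {ι : Type*} (s : Finset ι)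
    (g : ι → σ) {i : σ} (hi : ∀ j ∈ s, g j ≠ i) :
    MvPowerSeries.pderiv i (∏ j ∈ s, (MvPowerSeries.X (g j) : MvPowerSeries σ R)) = 0 :=
  Derivation.apply_prod_eq_zero _ s _ fun j hj => by rw [MvPowerSeries.pderiv_X, if_neg (hi j hj)]

end Derivations

/-! ## Singular points of hypersurfaces: the Jacobian necessary condition -/

section Hypersurface

variable {C : Type u} [CommRing C]

/-- **Leibniz**: for a derivation `D`, a prime `Q ∋ f` and `w ∉ Q` with `w f ∈ Q²`, one has
`D f ∈ Q` (`D(Q²) ⊆ Q`, so `w·Df + f·Dw ∈ Q`). [cite: StacksProject, Tag 07PF] -/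
theorem Derivation.apply_mem_of_mul_mem_sq {S₀ : Type*} [CommSemiring S₀] [Algebra S₀ C]
    (D : Derivation S₀ C C) {Q : Ideal C} [Q.IsPrime] {f w : C} (hfQ : f ∈ Q) (hw : w ∉ Q)
    (hwf : w * f ∈ Q ^ 2) : D f ∈ Q := by
  have key : ∀ x ∈ Q ^ 2, D x ∈ Q := by
    intro x hx
    rw [pow_two] at hx
    refine Submodule.mul_induction_on hx (fun a ha b hb => ?_) (fun a b ha hb => ?_)
    · rw [Derivation.leibniz, smul_eq_mul, smul_eq_mul]
      exact Q.add_mem (Q.mul_mem_right _ ha) (Q.mul_mem_right _ hb)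
    · rw [map_add]
      exact Q.add_mem ha hb
  have h1 : D (w * f) ∈ Q := key _ hwf
  rw [Derivation.leibniz, smul_eq_mul, smul_eq_mul] at h1
  have h2 : w * D f ∈ Q := (Ideal.add_mem_iff_left Q (Q.mul_mem_right _ hfQ)).mp h1
  exact (Ideal.IsPrime.mem_or_mem ‹_› h2).resolve_left hw

/-- The element `f` lies in the preimage of any ideal of `C/(f)`. [folklore] -/
theorem mem_comap_mk_span_singleton (f : C) (P : Ideal (C ⧸ Ideal.span {f})) :
    f ∈ P.comap (Ideal.Quotient.mk (Ideal.span {f})) := by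
  have h0 : Ideal.Quotient.mk (Ideal.span {f}) f = 0 :=
    Ideal.Quotient.eq_zero_iff_mem.mpr (Ideal.subset_span (Set.mem_singleton f))
  rw [Ideal.mem_comap, h0]
  exact P.zero_mem

/-- `(C/(f))_𝔮 ≅ C_𝔮/(f·C_𝔮)` for a prime `𝔮̄` of `C/(f)` with preimage `𝔮`. [folklore] -/
def localizationQuotientEquiv (f : C) (P : Ideal (C ⧸ Ideal.span {f})) [P.IsPrime] :
    Localization.AtPrime P ≃+*
      Localization.AtPrime (P.comap (Ideal.Quotient.mk (Ideal.span {f}))) ⧸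
        Ideal.span {algebraMap C
          (Localization.AtPrime (P.comap (Ideal.Quotient.mk (Ideal.span {f})))) f} := by
  let Q : Ideal C := P.comap (Ideal.Quotient.mk (Ideal.span {f}))
  haveI hQ : Q.IsPrime := Ideal.comap_isPrime _ P
  have hmap : (Ideal.span {f}).map (algebraMap C (Localization.AtPrime Q)) =
      Ideal.span {algebraMap C (Localization.AtPrime Q) f} := by
    rw [Ideal.map_span, Set.image_singleton]
  have hsub : Algebra.algebraMapSubmonoid (C ⧸ Ideal.span {f}) Q.primeCompl = P.primeCompl := by
    ext x
    constructor
    · rintro ⟨c, hc, rfl⟩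
      exact hc
    · intro hx
      obtain ⟨c, rfl⟩ := Ideal.Quotient.mk_surjective x
      exact ⟨c, hx, rfl⟩
  haveI : IsLocalization.AtPrime
      (Localization.AtPrime Q ⧸ (Ideal.span {f}).map (algebraMap C (Localization.AtPrime Q)))
      P := by
    change IsLocalization P.primeCompl _
    rw [← hsub]
    infer_instance
  exact (IsLocalization.algEquiv P.primeCompl (Localization.AtPrime P)
    (Localization.AtPrime Q ⧸ (Ideal.span {f}).map (algebraMap C (Localization.AtPrime Q)))
      ).toRingEquiv.trans (Ideal.quotEquivOfEq hmap)

/-- `(C/(f))_𝔮 ≅ C_𝔮/(f)` is a regular local ring as soon as `C_𝔮` is and `f ∉ 𝔮²C_𝔮`, i.e. as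
soon as no `w ∉ 𝔮` has `w f ∈ 𝔮²` (Matsumura Thm. 14.2). [cite: Matsumura1987, Thm. 14.2] -/
theorem isRegularLocalRing_localization_quotient_of_forall (f : C)
    (P : Ideal (C ⧸ Ideal.span {f})) [P.IsPrime]
    [IsRegularLocalRing (Localization.AtPrime (P.comap (Ideal.Quotient.mk (Ideal.span {f}))))]
    (h : ∀ w ∉ P.comap (Ideal.Quotient.mk (Ideal.span {f})),
      w * f ∉ P.comap (Ideal.Quotient.mk (Ideal.span {f})) ^ 2) :
    IsRegularLocalRing (Localization.AtPrime P) := by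
  set Q : Ideal C := P.comap (Ideal.Quotient.mk (Ideal.span {f})) with hQdef
  haveI hQ : Q.IsPrime := Ideal.comap_isPrime _ P
  have hfQ : f ∈ Q := mem_comap_mk_span_singleton f P
  have hfm : algebraMap C (Localization.AtPrime Q) f ∈ maximalIdeal (Localization.AtPrime Q) := by
    rw [← Localization.AtPrime.map_eq_maximalIdeal]
    exact Ideal.mem_map_of_mem _ hfQ
  have hfm2 : algebraMap C (Localization.AtPrime Q) f ∉
      maximalIdeal (Localization.AtPrime Q) ^ 2 := by
    rw [← Localization.AtPrime.map_eq_maximalIdeal, ← Ideal.map_pow,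
      IsLocalization.algebraMap_mem_map_algebraMap_iff Q.primeCompl]
    rintro ⟨u, hu, huf⟩
    exact h u hu huf
  haveI hreg : IsRegularLocalRing
      (Localization.AtPrime Q ⧸ Ideal.span {algebraMap C (Localization.AtPrime Q) f}) :=
    (IsRegularLocalRing.quotient_span_singleton hfm hfm2).1
  exact IsRegularLocalRing.of_ringEquiv (localizationQuotientEquiv f P).symm

/-- **Jacobian necessary condition for a singular point of a hypersurface** (Stacks 07PF read
contrapositively): in a regular ring `C`, if `(C/(f))_𝔮` is not a regular local ring then some
`w ∉ 𝔮` has `w f ∈ 𝔮²` (i.e. `f ∈ 𝔮²C_𝔮`). [cite: StacksProject, Tag 07PF] -/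
theorem exists_mul_mem_sq_of_not_isRegularLocalRing [IsRegularRing C] (f : C)
    (P : Ideal (C ⧸ Ideal.span {f})) [P.IsPrime]
    (hP : ¬ IsRegularLocalRing (Localization.AtPrime P)) :
    ∃ w ∉ P.comap (Ideal.Quotient.mk (Ideal.span {f})),
      w * f ∈ P.comap (Ideal.Quotient.mk (Ideal.span {f})) ^ 2 := by
  by_contra hcon
  haveI : (P.comap (Ideal.Quotient.mk (Ideal.span {f}))).IsPrime := Ideal.comap_isPrime _ P
  refine hP (isRegularLocalRing_localization_quotient_of_forall f P fun w hw hwf => ?_)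
  exact hcon ⟨w, hw, hwf⟩

/-- In a regular ring `C`: if `(C/(f))_𝔮` is not regular, then `D f ∈ 𝔮` for every derivation
`D` of `C`. [cite: StacksProject, Tag 07PF] -/
theorem Derivation.apply_mem_comap_of_not_isRegularLocalRing [IsRegularRing C] {S₀ : Type*}
    [CommSemiring S₀] [Algebra S₀ C] (D : Derivation S₀ C C) (f : C)
    (P : Ideal (C ⧸ Ideal.span {f})) [P.IsPrime]
    (hP : ¬ IsRegularLocalRing (Localization.AtPrime P)) :
    D f ∈ P.comap (Ideal.Quotient.mk (Ideal.span {f})) := by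
  haveI : (P.comap (Ideal.Quotient.mk (Ideal.span {f}))).IsPrime := Ideal.comap_isPrime _ P
  obtain ⟨w, hw, hwf⟩ := exists_mul_mem_sq_of_not_isRegularLocalRing f P hP
  exact Derivation.apply_mem_of_mul_mem_sq D (mem_comap_mk_span_singleton f P) hw hwf

/-- **A hypersurface is singular along `f ∈ 𝔮²`**: in a regular domain `C`, if `0 ≠ f ∈ 𝔮²`
then `(C/(f))_𝔮 ≅ C_𝔮/(f)` is not a regular local ring (its embedding dimension is that of
`C_𝔮`, its dimension one less). [cite: Matsumura1987, Thm. 14.2] -/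
theorem not_isRegularLocalRing_localization_quotient_of_mem_sq [IsRegularRing C] [IsDomain C]
    {f : C} (hf0 : f ≠ 0) (P : Ideal (C ⧸ Ideal.span {f})) [P.IsPrime]
    (hf2 : f ∈ P.comap (Ideal.Quotient.mk (Ideal.span {f})) ^ 2) :
    ¬ IsRegularLocalRing (Localization.AtPrime P) := by
  intro hreg
  set Q : Ideal C := P.comap (Ideal.Quotient.mk (Ideal.span {f})) with hQdef
  haveI hQ : Q.IsPrime := Ideal.comap_isPrime _ P
  set S := Localization.AtPrime Q with hSdef
  haveI : IsRegularLocalRing S := IsRegularRing.isRegularLocalRing_localization Q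
  haveI : IsDomain S := isDomain_of_isRegularLocalRing S
  set f' : S := algebraMap C S f with hf'
  have hfm2 : f' ∈ maximalIdeal S ^ 2 := by
    rw [hf', ← Localization.AtPrime.map_eq_maximalIdeal, ← Ideal.map_pow]
    exact Ideal.mem_map_of_mem _ hf2
  have hfm : f' ∈ maximalIdeal S := Ideal.pow_le_self two_ne_zero hfm2
  have hf'0 : f' ≠ 0 := by
    intro h0
    apply hf0
    have hinj : Function.Injective (algebraMap C S) :=
      IsLocalization.injective S (Ideal.primeCompl_le_nonZeroDivisors Q)
    rw [hf', ← map_zero (algebraMap C S)] at h0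
    exact hinj h0
  haveI hreg' : IsRegularLocalRing (S ⧸ Ideal.span {f'}) :=
    IsRegularLocalRing.of_ringEquiv (localizationQuotientEquiv f P)
  -- dimensions and embedding dimensions
  have hdim : ringKrullDim (S ⧸ Ideal.span {f'}) + 1 = ringKrullDim S :=
    ringKrullDim_quotient_span_singleton_succ_eq_ringKrullDim_of_mem_nonZeroDivisors
      (mem_nonZeroDivisors_of_ne_zero hf'0) hfm
  haveI : Nontrivial (S ⧸ Ideal.span {f'}) :=
    Ideal.Quotient.nontrivial_iff.mpr (by
      rw [Ne, Ideal.span_singleton_eq_top]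
      exact fun hu => (mem_maximalIdeal _).mp hfm hu)
  have hemb := spanFinrank_maximalIdeal_le_spanFinrank_map_of_mem_sq hfm2
  rw [← maximalIdeal_quotient_eq_map (Ideal.span {f'})] at hemb
  have h1 : ((maximalIdeal S).spanFinrank : WithBot ℕ∞) = ringKrullDim S :=
    IsRegularLocalRing.spanFinrank_maximalIdeal
  have h2 : ((maximalIdeal (S ⧸ Ideal.span {f'})).spanFinrank : WithBot ℕ∞) =
      ringKrullDim (S ⧸ Ideal.span {f'}) :=
    IsRegularLocalRing.spanFinrank_maximalIdeal
  obtain ⟨n, hn⟩ := exists_nat_cast_eq_ringKrullDim (R := S ⧸ Ideal.span {f'})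
  rw [hn] at hdim h2
  rw [← hdim] at h1
  have h1' : (maximalIdeal S).spanFinrank = n + 1 := by exact_mod_cast h1
  have h2' : (maximalIdeal (S ⧸ Ideal.span {f'})).spanFinrank = n := by exact_mod_cast h2
  omega

end Hypersurface

end Literature.AlgebraicGeometry.Resolution

end
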